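import Summits.QuantumFields.BalabanUV.Beta.FP.TorusNBindingOfJunctions
import Summits.QuantumFields.BalabanUV.Beta.FP.PeriodisedFormIndexWard
import Summits.QuantumFields.BalabanUV.Beta.FP.NestedStepLawTorusTransportedRowsGradedSym

/-!
# `BalabanUV.Beta.FP.TorusNBindingOfJunctionsGauge` — road «FP» for binder row D1, ROUTE T (β1), SPEC-50 (E4d) under RULING R-FP-79 (J-RISK-1′ = option (i)):
# **THE END WRAPPER's N-BINDING `hHN₁` FROM (J-W″) + (J-X) + (J-Λ) WITH THE TREE-GAUGE READ-OUT = THE SLICE-CHANGE PARAMETER** — the nested direction is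
# `r·colN − tgrad·λ` (g39 `TorusOneShotColumnGaugeProj*`: one-shot column = gauge projection of the nested column), the Wilson cubic family inserted along the
# exact part is `½·[H₀, E_λ]` (leaf-05 g27 `PeriodisedFormIndexWard`), and #21's `X = −c·E_λ` conjugation CANCELS it: the W-sector of `H′₁f (dv)` is `cE·Σ_b colN_b·W_b`

WHY.  g38's (E4c) `TorusNBindingOfJunctions.hHN1_shape_of_junctions` read `hHN₁` under R-FP-77 (ii) (`lv` constant ⇒ the conjugation vanishes) with the W junction
TERMWISE `(−2c)·hb (n+1) b = cE·colN b`.  g39 LOCATED (Q-FP-39-1; `TorusOneShotColumnGaugeProjSym.XN_toBlocks₁₂_mulVec_eq_gaugeProj_sym`, kernel) that the nested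
column `hv` and the one-shot N column differ by the exact tower mode `W₀θ = tgrad·λ̂θ`: termwise (J-W) holds iff `P·hv(dv) = 0`.  RULING R-FP-79: the instantiation
takes `lv(dv) := −λ̂(θ(dv))`, so the nested direction is `hb (n+1) (dv) = r·colN − tgrad·lv(dv)` ((J-W″), `(−2c)·r = cE (n+2)`), and the Wilson sector inserted along
`tgrad·λ` is `½·(H₀·E_λ − E_λ·H₀)` ((J-X), leaf-05 g27's pure-gauge law of the periodised cubic Wilson family, ANY box) — exactly what #21's conjugation
`−XᵀH₀ + (·) + H₀X`, `X = −c·E_λ`, removes.  THIS FILE re-assembles (E4c) in that currency.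

WHAT ([folklore] matrix bookkeeping BY NAME; no `def`, no `def … : Prop`, nothing cited, 0 sorry):
* §1 `torus_form_pureGauge_fun_of_box` — leaf-05's `torus_form_pureGauge_of_box` summed along a torus gauge FUNCTION `λ` on ANY box (their `torus_H1_pureGauge_fun` is the
  box `fine Lc M′`): `Σ_b (Σ_s tgrad M (b.1, inl b.2) s · λ s) • W_b|ff = ½ • (H₀·E_λ − E_λ·H₀)`; `conj_add_wSector_exact` (the cancellation, pure algebra).
* §2 **`hHN1_shape_of_junctions_gauge`** — at the wrapper's objects (`T := towerTorus Lc (fine Lc M) (n+1)`, generic `H₀ c w cf 𝒽 lev rs hb l N₁ r`): the `hHN₁`-shaped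
  equation (its two sides VERBATIM after `rw [hH'₁f, hH₁f]`) FOLLOWS from (J-W″) `hb (n+1) b = r·colN b − (tgrad·l) b`, the pin `(−2c)·r = cE (n+2)`, (J-X) as a
  hypothesis `hX` on `H₀`, and (J-Λ) (one matrix identity, as in (E4c)); right side = an2 PART 11 `perF_dper_VN_submatrix_ff_tower`.
* §3 **`hHN1_named_of_junctions_gauge_pin`** — the ROW ITSELF at one direction: with the wrapper's namings `hH₁f ∕ hH'₁f` at `v := dv (μ,y)` displayed as values
  and (J-X) DISCHARGED at the wrapper's form pin `hH₀ : H₀ = (perF T (bhKStepSh d Lc (Dsh Lc) 0))|ff` (leaf-02 `perF_bhKStepSh_Dsh_ff_eq_perF_bhKStepAt` + §1):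
  `H′₁ = (perF T (dper T (VN R P (n+1) μ y)))|ff`.
WHAT THIS IS NOT: not (J-W″)'s instantiation (`TorusOneShotColumnGaugeProjSym` + `hLN ∕ hEAN` give it; the slot bookkeeping `fN a = (wrapPt T (N•y), inr μ)` is the
instantiation's), not (J-Λ) (an2 PART 14∕15∕16 + `TorusLamJunctionShape`), not the `𝔔`-side `hQN₁` (leaf-02's averaging pure-gauge law), not second order; no row of
the END wrapper discharged; nothing of Bałaban's asserted, valued or discharged; 0 estimates; 0∕4 row-D1 binders (hW, hR, D1Tel, D1Rep); ROOT M‴ p325680 untouched;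
NOT (C1), NOT (L2′), NOT (T-ID), NOT SDF, NOT D1, NOT BetaPertH, NOT continuum, NOT Clay.

HONEST DEPENDENCY (page 1, mandatory): continuum YM on T⁴ ⇐ BetaPertH ∧ nine spine estimates (0/9 proved); BetaPertH ⇐ (D1) ∧ (D4) ∧ CAP+tail;
G-an2-4 gates asym, D1 and NE2/3/4.  HONEST FRAMING (cell contract, verbatim): «discharging `BetaPertH` makes Bałaban's UV stability UNCONDITIONAL —
a real constructive-QFT result; it is NOT the continuum limit and NOT the Clay problem.»  ABSOLUTE RULE (cell charter, verbatim): «No internally-minted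
statement may enter as a cited fact. Every hypothesis is either kernel-proved in this package or a verbatim quotation of a PUBLISHED theorem with page
reference. The manuscript(s) under audit are NOT citable for their own disputed steps — they are the thing under adjudication; programme-internal
(2001/route/tribunal) claims are never citable.»  Road «FP» OWNER, b2b-balaban-beta-d1-p3 gen 39, 2026-08-27.  No existing file touched.
-/

noncomputable section

open scoped BigOperators

namespace Summit.QuantumFields.BalabanUV.Beta.FP.TorusNBindingOfJunctionsGauge

open Finset Matrix
open Literature.MathematicalPhysics.QuantumFieldTheory.Balaban1983to89 Literature.MathematicalPhysics.QuantumFieldTheory.Balaban1983to89.Beta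
open B5Prop11Plancherel (fine)  open B6Lemma24Torus (pbox)
open AffineAveraging (Site toSite)  open AveragingContoursRooted (ctrOff)
open ExpKernelCalculus (MKer)  open OneStepResolventKernel (Fib KInv)  open InterLevelTransport (SLam)
open BalabanStepJets (lamCoeffOf)  open StepJetData (wilsonA)
open Summit.QuantumFields.BalabanUV.Beta.BorderedHessian (bhKStepAt)
open Summit.QuantumFields.BalabanUV.Beta.SymShiftedSpread (bhKStepSh)
open Summit.QuantumFields.BalabanUV.Beta.DshAn1 (Dsh)
open Summit.QuantumFields.BalabanUV.Beta.CompositeOneShotJets (compH)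
open Summit.QuantumFields.BalabanUV.Beta.CompositeOneShotJetData (Roots Pins AN VN)
open Summit.QuantumFields.BalabanUV.Beta.NVertexSectorsPeriodised (perF_dper_VN_submatrix_ff_tower)
open Summit.QuantumFields.BalabanUV.Beta.FP.KernelPeriodisationFib (Idx perF)
open Summit.QuantumFields.BalabanUV.Beta.FP.KernelPeriodisationFibLoc (dper)
open Summit.QuantumFields.BalabanUV.Beta.FP.TorusGaugeCovariance (tdelta tgrad)
open Summit.QuantumFields.BalabanUV.Beta.FP.TorusGaugeCovariancePairing (wrapPt sum_tdelta_mul wrapPt_of_mem)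
open Summit.QuantumFields.BalabanUV.Beta.FP.TorusCompositeObjects (towerTorus)
open Summit.QuantumFields.BalabanUV.Beta.FP.TorusCompositeCompanionSumG (compSumSym)  open Summit.QuantumFields.BalabanUV.Beta.FP.TorusCompositeCompanionFamilyG (onTowerFamily)
open Summit.QuantumFields.BalabanUV.Beta.FP.TorusNBindingOfJunctions (wTerm_eq_of_junction)
open Summit.QuantumFields.BalabanUV.Beta.FP.PeriodisedFormIndexWard (torus_form_pureGauge_of_box)
open Summit.QuantumFields.BalabanUV.Beta.FP.NestedStepLawTorusTransportedRowsGradedSym (perF_bhKStepSh_Dsh_ff_eq_perF_bhKStepAt)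

variable {d : ℕ}

/-! ## §1 The Wilson cubic family along a torus gauge FUNCTION, on any box; the cancellation against #21's conjugation -/

section PureGauge

variable (M : Fin (d + 1) → ℕ) [∀ μ, NeZero (M μ)]

/-- [folklore] **`Σ_b (tgrad·λ)_b • W_b|ff = ½ • (H₀·E_λ − E_λ·H₀)` ON ANY BOX** (`W_b := perF M (dper M (wilsonA b))|ff`, `E_λ := diagonal (λ ∘ pr)`, `H₀` the level-0
form block `perF M (bhKStepAt d ρ L 0)|ff`, any root ∕ window) — leaf-05 g27's `torus_form_pureGauge_of_box` (one torus gauge parameter `s`) summed along `λ`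
(their `torus_H1_pureGauge_fun` is the case `M := fine Lc M′`; same proof). -/
theorem torus_form_pureGauge_fun_of_box (ρ : Site (d + 1)) (L : ℕ) [NeZero L] (lam : ↥(pbox M) → ℝ)
    {H₀ : Matrix (↥(pbox M) × Fin (d + 1)) (↥(pbox M) × Fin (d + 1)) ℝ}
    (hH₀ : H₀ = (perF M (bhKStepAt d ρ L 0)).submatrix (fun b : ↥(pbox M) × Fin (d + 1) => ((b.1, Sum.inl b.2) : Idx M (Fib d)))
        (fun b : ↥(pbox M) × Fin (d + 1) => ((b.1, Sum.inl b.2) : Idx M (Fib d)))) :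
    (∑ b : ↥(pbox M) × Fin (d + 1), (∑ s : ↥(pbox M), tgrad M (b.1, Sum.inl b.2) s * lam s) •
        (perF M (dper M (wilsonA d b.2 (b.1 : Site (d + 1))))).submatrix
          (fun b : ↥(pbox M) × Fin (d + 1) => ((b.1, Sum.inl b.2) : Idx M (Fib d)))
          (fun b : ↥(pbox M) × Fin (d + 1) => ((b.1, Sum.inl b.2) : Idx M (Fib d))))
      = (1 / 2 : ℝ) • (H₀ * Matrix.diagonal (fun b : ↥(pbox M) × Fin (d + 1) => lam b.1)
          - Matrix.diagonal (fun b : ↥(pbox M) × Fin (d + 1) => lam b.1) * H₀) := by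
  have hswap : (∑ b : ↥(pbox M) × Fin (d + 1), (∑ s : ↥(pbox M), tgrad M (b.1, Sum.inl b.2) s * lam s) •
        (perF M (dper M (wilsonA d b.2 (b.1 : Site (d + 1))))).submatrix
          (fun b : ↥(pbox M) × Fin (d + 1) => ((b.1, Sum.inl b.2) : Idx M (Fib d)))
          (fun b : ↥(pbox M) × Fin (d + 1) => ((b.1, Sum.inl b.2) : Idx M (Fib d))))
      = ∑ s : ↥(pbox M), lam s • ∑ b : ↥(pbox M) × Fin (d + 1), tgrad M (b.1, Sum.inl b.2) s •
        (perF M (dper M (wilsonA d b.2 (b.1 : Site (d + 1))))).submatrix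
          (fun b : ↥(pbox M) × Fin (d + 1) => ((b.1, Sum.inl b.2) : Idx M (Fib d)))
          (fun b : ↥(pbox M) × Fin (d + 1) => ((b.1, Sum.inl b.2) : Idx M (Fib d))) := by
    simp only [Finset.sum_smul, Finset.smul_sum, smul_smul, mul_comm (lam _)]
    exact Finset.sum_comm
  rw [hswap, Finset.sum_congr rfl fun s _ => by rw [torus_form_pureGauge_of_box M ρ L s hH₀]]
  ext x z
  simp only [Matrix.sum_apply, Matrix.smul_apply, Matrix.sub_apply, Matrix.diagonal_mul, Matrix.mul_diagonal, smul_eq_mul]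
  rw [show lam z.1 = ∑ s : ↥(pbox M), tdelta M ((z.1 : ↥(pbox M)) : Site (d + 1)) s * lam s by rw [sum_tdelta_mul, wrapPt_of_mem],
    show lam x.1 = ∑ s : ↥(pbox M), tdelta M ((x.1 : ↥(pbox M)) : Site (d + 1)) s * lam s by rw [sum_tdelta_mul, wrapPt_of_mem]]
  simp only [Finset.mul_sum, Finset.sum_mul, mul_sub, Finset.sum_sub_distrib]
  congr 1 <;> exact Finset.sum_congr rfl fun s _ => by ring

end PureGauge

section Algebra

variable {β ν : Type*} [Fintype β] [Fintype ν] [DecidableEq ν]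

/-- [folklore] **THE CANCELLATION**: if the direction is `r·col − g` TERMWISE, the family inserted along `g` is `½·(H₀E − EH₀)`, and `(−2c)·r = cE`, then #21's conjugation by
`X = −(c•E)` (`E` diagonal) of the `(−2c)`-weighted insertion along the direction IS the `cE`-weighted insertion along `col`:
`−((−(c•E))ᵀ·H₀) + (−2c)•Σ_b h_b•W_b + H₀·(−(c•E)) = cE•Σ_b col_b•W_b`. -/
theorem conj_add_wSector_exact (c r cE : ℝ) (hr : (-2 * c) * r = cE) (h col g : β → ℝ) (W : β → Matrix ν ν ℝ) (H₀ : Matrix ν ν ℝ) (e : ν → ℝ)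
    (hh : ∀ b, h b = r * col b - g b)
    (hX : ∑ b, g b • W b = (1 / 2 : ℝ) • (H₀ * Matrix.diagonal e - Matrix.diagonal e * H₀)) :
    -((-(c • Matrix.diagonal e))ᵀ * H₀) + (-2 * c) • ∑ b, h b • W b + H₀ * (-(c • Matrix.diagonal e)) = cE • ∑ b, col b • W b := by
  have hsplit : (-2 * c) • ∑ b, h b • W b = cE • ∑ b, col b • W b - (-2 * c) • ∑ b, g b • W b := by
    rw [← hr, Finset.smul_sum, Finset.smul_sum, Finset.smul_sum, ← Finset.sum_sub_distrib]
    refine Finset.sum_congr rfl ?_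
    intro b _
    rw [hh b, smul_smul, smul_smul, smul_smul, ← sub_smul]
    congr 1
    ring
  have h1 : -((-(c • Matrix.diagonal e))ᵀ * H₀) = c • (Matrix.diagonal e * H₀) := by
    rw [Matrix.transpose_neg, Matrix.transpose_smul, Matrix.diagonal_transpose, Matrix.neg_mul, neg_neg, Matrix.smul_mul]
  have h2 : H₀ * (-(c • Matrix.diagonal e)) = -(c • (H₀ * Matrix.diagonal e)) := by
    rw [Matrix.mul_neg, Matrix.mul_smul]
  rw [h1, h2, hsplit, hX]
  ext i j
  simp only [Matrix.add_apply, Matrix.sub_apply, Matrix.smul_apply, Matrix.neg_apply, smul_eq_mul, Matrix.mul_diagonal, Matrix.diagonal_mul]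
  ring

end Algebra

/-! ## §2 The `hHN₁`-shaped equation from (J-W″) + (J-X) + (J-Λ) at the wrapper's objects -/

section Wrapper

variable {Lc : ℕ} [NeZero Lc] (R : Roots Lc) (P : Pins) (N₁ n : ℕ) (M : Fin (3 + 1) → ℕ) [∀ μ, NeZero (M μ)] (lev : ℕ → ℕ) (rs : ℕ → (Fin (3 + 1) → ℕ))
  (𝒽 : Fin (3 + 1) → Site (3 + 1) → MKer (3 + 1) (Fib 3))
  (cf : ℕ → Fin (3 + 1) → Site (3 + 1) → Fin (3 + 1) → Site (3 + 1) → ℝ) (w : ℕ → ℝ) (c r : ℝ)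
  (hb : (k : ℕ) → (↥(pbox (towerTorus Lc (fine Lc M) k)) × Fin (3 + 1) → ℝ))
  (H₀ : Matrix (↥(pbox (towerTorus Lc (fine Lc M) (n + 1))) × Fin (3 + 1)) (↥(pbox (towerTorus Lc (fine Lc M) (n + 1))) × Fin (3 + 1)) ℝ)
  (l : ↥(pbox (towerTorus Lc (fine Lc M) (n + 1))) → ℝ) (μ : Fin (3 + 1)) (y : Site (3 + 1))
  -- the pin `(−2c)·r = cE (n+2)` of the direction's scale
  (hr : (-2 * c) * r = P.cE (n + 1 + 1))
  -- (J-W″) the nested direction at the top storey is `r·colN − tgrad·l` TERMWISE (g39 `TorusOneShotColumnGaugeProj*` + the N leg `hLN ∕ hEAN`, with `l := lv (dv)`)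
  (hJW : ∀ b : ↥(pbox (towerTorus Lc (fine Lc M) (n + 1))) × Fin (3 + 1),
    hb (n + 1) b = r * perF (towerTorus Lc (fine Lc M) (n + 1)) (AN R (n + 1)) (b.1, Sum.inl b.2)
        (wrapPt (towerTorus Lc (fine Lc M) (n + 1)) (((Lc ^ (n + 1 + 1) : ℕ) : ℤ) • y), Sum.inr μ)
      - ∑ s : ↥(pbox (towerTorus Lc (fine Lc M) (n + 1))), tgrad (towerTorus Lc (fine Lc M) (n + 1)) (b.1, Sum.inl b.2) s * l s)
  -- (J-Λ) the Λ junction along the nested direction: the wrapper's Λ terms ARE the periodised Λ sector of the N-vertex (ONE matrix identity; (E4b) ∕ an2 PART 14–16)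
  (hJΛ : w (n + 1) • ∑ ā : ↥(pbox (towerTorus Lc (fine Lc M) (n + 1))) × Fin (3 + 1), hb (n + 1) ā •
        (perF (towerTorus Lc (fine Lc M) (n + 1)) (dper (towerTorus Lc (fine Lc M) (n + 1)) (SLam N₁ (cf (n + 1)) 𝒽 ā.2 (ā.1 : Site (3 + 1))))).submatrix
          (fun p : ↥(pbox (towerTorus Lc (fine Lc M) (n + 1))) × Fin (3 + 1) => ((p.1, Sum.inl p.2) : Idx (towerTorus Lc (fine Lc M) (n + 1)) (Fib 3)))
          (fun p : ↥(pbox (towerTorus Lc (fine Lc M) (n + 1))) × Fin (3 + 1) => ((p.1, Sum.inl p.2) : Idx (towerTorus Lc (fine Lc M) (n + 1)) (Fib 3)))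
      + compSumSym Lc (onTowerFamily Lc (fine Lc M) (fun k => w k • ∑ ā : ↥(pbox (towerTorus Lc (fine Lc M) k)) × Fin (3 + 1), hb k ā •
        (perF (towerTorus Lc (fine Lc M) k) (dper (towerTorus Lc (fine Lc M) k) (SLam N₁ (cf k) 𝒽 ā.2 (ā.1 : Site (3 + 1))))).submatrix
          (fun p : ↥(pbox (towerTorus Lc (fine Lc M) k)) × Fin (3 + 1) => ((p.1, Sum.inl p.2) : Idx (towerTorus Lc (fine Lc M) k) (Fib 3)))
          (fun p : ↥(pbox (towerTorus Lc (fine Lc M) k)) × Fin (3 + 1) => ((p.1, Sum.inl p.2) : Idx (towerTorus Lc (fine Lc M) k) (Fib 3))))) (fine Lc M) lev rs (n + 1)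
    = P.cΛ (n + 1 + 1) • ∑ b : ↥(pbox (towerTorus Lc (fine Lc M) (n + 1))) × Fin (3 + 1),
        perF (towerTorus Lc (fine Lc M) (n + 1)) (AN R (n + 1)) (b.1, Sum.inl b.2)
            (wrapPt (towerTorus Lc (fine Lc M) (n + 1)) (((Lc ^ (n + 1 + 1) : ℕ) : ℤ) • y), Sum.inr μ) •
          (perF (towerTorus Lc (fine Lc M) (n + 1)) (dper (towerTorus Lc (fine Lc M) (n + 1))
            (SLam (Lc ^ (n + 1 + 1)) (lamCoeffOf (KInv (N := Lc ^ (n + 1 + 1)) (d := 3)) (Lc ^ (n + 1 + 1))) (compH R.r Lc (n + 1 + 1)) b.2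
              (b.1 : Site (3 + 1))))).submatrix
            (fun b : ↥(pbox (towerTorus Lc (fine Lc M) (n + 1))) × Fin (3 + 1) => ((b.1, Sum.inl b.2) : Idx (towerTorus Lc (fine Lc M) (n + 1)) (Fib 3)))
            (fun b : ↥(pbox (towerTorus Lc (fine Lc M) (n + 1))) × Fin (3 + 1) => ((b.1, Sum.inl b.2) : Idx (towerTorus Lc (fine Lc M) (n + 1)) (Fib 3))))
include hr hJW hJΛ

/-- [folklore] **`hHN1_shape_of_junctions_gauge` — THE N-BINDING's EQUATION FROM (J-W″) + (J-X) + (J-Λ)** with the tree-gauge read-out `l` = the slice-change parameter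
(R-FP-79): the `hHN₁`-shaped matrix equation (left side = `hH'₁f` with `hH₁f` substituted, `X = −(c • diagonal (l ∘ pr))`; right side = `(perF T (dper T (VN R P (n+1) μ y)))|ff`)
HOLDS whenever the top-storey direction is `r·colN − tgrad·l` termwise, the Wilson cubic family inserted along `tgrad·l` is `½·(H₀·E_l − E_l·H₀)` (`hX`, (J-X) — discharged
at the wrapper's form pin in §3), `(−2c)·r = cE (n+2)`, and the Λ junction holds as one matrix identity — the conjugation CANCELS the exact part of the W-sector (§1) and
an2's PART 11 `perF_dper_VN_submatrix_ff_tower` is the right side. -/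
theorem hHN1_shape_of_junctions_gauge
    (hX : ∑ b : ↥(pbox (towerTorus Lc (fine Lc M) (n + 1))) × Fin (3 + 1),
        (∑ s : ↥(pbox (towerTorus Lc (fine Lc M) (n + 1))), tgrad (towerTorus Lc (fine Lc M) (n + 1)) (b.1, Sum.inl b.2) s * l s) •
          (perF (towerTorus Lc (fine Lc M) (n + 1)) (dper (towerTorus Lc (fine Lc M) (n + 1)) (wilsonA 3 b.2 (b.1 : Site (3 + 1))))).submatrix
            (fun b : ↥(pbox (towerTorus Lc (fine Lc M) (n + 1))) × Fin (3 + 1) => ((b.1, Sum.inl b.2) : Idx (towerTorus Lc (fine Lc M) (n + 1)) (Fib 3)))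
            (fun b : ↥(pbox (towerTorus Lc (fine Lc M) (n + 1))) × Fin (3 + 1) => ((b.1, Sum.inl b.2) : Idx (towerTorus Lc (fine Lc M) (n + 1)) (Fib 3)))
      = (1 / 2 : ℝ) • (H₀ * Matrix.diagonal (fun b : ↥(pbox (towerTorus Lc (fine Lc M) (n + 1))) × Fin (3 + 1) => l b.1)
          - Matrix.diagonal (fun b : ↥(pbox (towerTorus Lc (fine Lc M) (n + 1))) × Fin (3 + 1) => l b.1) * H₀)) :
    -((-(c • Matrix.diagonal (fun b : ↥(pbox (towerTorus Lc (fine Lc M) (n + 1))) × Fin (3 + 1) => l b.1)))ᵀ * H₀)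
      + ((-2 * c) • ∑ b : ↥(pbox (towerTorus Lc (fine Lc M) (n + 1))) × Fin (3 + 1), hb (n + 1) b •
          (perF (towerTorus Lc (fine Lc M) (n + 1)) (dper (towerTorus Lc (fine Lc M) (n + 1)) (wilsonA 3 b.2 (b.1 : Site (3 + 1))))).submatrix
            (fun b : ↥(pbox (towerTorus Lc (fine Lc M) (n + 1))) × Fin (3 + 1) => ((b.1, Sum.inl b.2) : Idx (towerTorus Lc (fine Lc M) (n + 1)) (Fib 3)))
            (fun b : ↥(pbox (towerTorus Lc (fine Lc M) (n + 1))) × Fin (3 + 1) => ((b.1, Sum.inl b.2) : Idx (towerTorus Lc (fine Lc M) (n + 1)) (Fib 3)))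
        + w (n + 1) • ∑ ā : ↥(pbox (towerTorus Lc (fine Lc M) (n + 1))) × Fin (3 + 1), hb (n + 1) ā •
          (perF (towerTorus Lc (fine Lc M) (n + 1)) (dper (towerTorus Lc (fine Lc M) (n + 1)) (SLam N₁ (cf (n + 1)) 𝒽 ā.2 (ā.1 : Site (3 + 1))))).submatrix
            (fun b : ↥(pbox (towerTorus Lc (fine Lc M) (n + 1))) × Fin (3 + 1) => ((b.1, Sum.inl b.2) : Idx (towerTorus Lc (fine Lc M) (n + 1)) (Fib 3)))
            (fun b : ↥(pbox (towerTorus Lc (fine Lc M) (n + 1))) × Fin (3 + 1) => ((b.1, Sum.inl b.2) : Idx (towerTorus Lc (fine Lc M) (n + 1)) (Fib 3)))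
        + compSumSym Lc (onTowerFamily Lc (fine Lc M) (fun k => w k • ∑ ā : ↥(pbox (towerTorus Lc (fine Lc M) k)) × Fin (3 + 1), hb k ā •
          (perF (towerTorus Lc (fine Lc M) k) (dper (towerTorus Lc (fine Lc M) k) (SLam N₁ (cf k) 𝒽 ā.2 (ā.1 : Site (3 + 1))))).submatrix
            (fun b : ↥(pbox (towerTorus Lc (fine Lc M) k)) × Fin (3 + 1) => ((b.1, Sum.inl b.2) : Idx (towerTorus Lc (fine Lc M) k) (Fib 3)))
            (fun b : ↥(pbox (towerTorus Lc (fine Lc M) k)) × Fin (3 + 1) => ((b.1, Sum.inl b.2) : Idx (towerTorus Lc (fine Lc M) k) (Fib 3))))) (fine Lc M) lev rs (n + 1))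
      + H₀ * (-(c • Matrix.diagonal (fun b : ↥(pbox (towerTorus Lc (fine Lc M) (n + 1))) × Fin (3 + 1) => l b.1)))
      = (perF (towerTorus Lc (fine Lc M) (n + 1)) (dper (towerTorus Lc (fine Lc M) (n + 1)) (VN R P (n + 1) μ y))).submatrix
          (fun b : ↥(pbox (towerTorus Lc (fine Lc M) (n + 1))) × Fin (3 + 1) => ((b.1, Sum.inl b.2) : Idx (towerTorus Lc (fine Lc M) (n + 1)) (Fib 3)))
          (fun b : ↥(pbox (towerTorus Lc (fine Lc M) (n + 1))) × Fin (3 + 1) => ((b.1, Sum.inl b.2) : Idx (towerTorus Lc (fine Lc M) (n + 1)) (Fib 3))) := by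
  -- regroup: conjugation + W-sector first, then the Λ terms
  have key := conj_add_wSector_exact c r (P.cE (n + 1 + 1)) hr (hb (n + 1))
    (fun b => perF (towerTorus Lc (fine Lc M) (n + 1)) (AN R (n + 1)) (b.1, Sum.inl b.2)
      (wrapPt (towerTorus Lc (fine Lc M) (n + 1)) (((Lc ^ (n + 1 + 1) : ℕ) : ℤ) • y), Sum.inr μ))
    (fun b => ∑ s : ↥(pbox (towerTorus Lc (fine Lc M) (n + 1))), tgrad (towerTorus Lc (fine Lc M) (n + 1)) (b.1, Sum.inl b.2) s * l s)
    (fun b => (perF (towerTorus Lc (fine Lc M) (n + 1)) (dper (towerTorus Lc (fine Lc M) (n + 1)) (wilsonA 3 b.2 (b.1 : Site (3 + 1))))).submatrix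
            (fun b : ↥(pbox (towerTorus Lc (fine Lc M) (n + 1))) × Fin (3 + 1) => ((b.1, Sum.inl b.2) : Idx (towerTorus Lc (fine Lc M) (n + 1)) (Fib 3)))
            (fun b : ↥(pbox (towerTorus Lc (fine Lc M) (n + 1))) × Fin (3 + 1) => ((b.1, Sum.inl b.2) : Idx (towerTorus Lc (fine Lc M) (n + 1)) (Fib 3))))
    H₀ (fun b => l b.1) hJW hX
  rw [show ∀ (A B C D E : Matrix (↥(pbox (towerTorus Lc (fine Lc M) (n + 1))) × Fin (3 + 1)) (↥(pbox (towerTorus Lc (fine Lc M) (n + 1))) × Fin (3 + 1)) ℝ),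
      A + (B + C + D) + E = (A + B + E) + (C + D) from fun A B C D E => by abel, key, hJΛ]
  exact (perF_dper_VN_submatrix_ff_tower R P M n μ y).symm

end Wrapper

/-! ## §3 (J-X) discharged at the wrapper's form pin -/

section Pin

variable {Lc : ℕ} [NeZero Lc] (R : Roots Lc) (P : Pins) (N₁ n : ℕ) (M : Fin (3 + 1) → ℕ) [∀ μ, NeZero (M μ)] (lev : ℕ → ℕ) (rs : ℕ → (Fin (3 + 1) → ℕ))
  (𝒽 : Fin (3 + 1) → Site (3 + 1) → MKer (3 + 1) (Fib 3))
  (cf : ℕ → Fin (3 + 1) → Site (3 + 1) → Fin (3 + 1) → Site (3 + 1) → ℝ) (w : ℕ → ℝ) (c r : ℝ)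
  (hb : (k : ℕ) → (↥(pbox (towerTorus Lc (fine Lc M) k)) × Fin (3 + 1) → ℝ))
  {H₀ : Matrix (↥(pbox (towerTorus Lc (fine Lc M) (n + 1))) × Fin (3 + 1)) (↥(pbox (towerTorus Lc (fine Lc M) (n + 1))) × Fin (3 + 1)) ℝ}
  -- the wrapper's form pin at the finest storey (`hH₀ n B`, level `n+1−(n+1) = 0`)
  (hH₀ : H₀ = (perF (towerTorus Lc (fine Lc M) (n + 1)) (bhKStepSh 3 Lc (Dsh Lc) 0)).submatrix
        (fun b : ↥(pbox (towerTorus Lc (fine Lc M) (n + 1))) × Fin (3 + 1) => ((b.1, Sum.inl b.2) : Idx (towerTorus Lc (fine Lc M) (n + 1)) (Fib 3)))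
        (fun b : ↥(pbox (towerTorus Lc (fine Lc M) (n + 1))) × Fin (3 + 1) => ((b.1, Sum.inl b.2) : Idx (towerTorus Lc (fine Lc M) (n + 1)) (Fib 3))))
  (l : ↥(pbox (towerTorus Lc (fine Lc M) (n + 1))) → ℝ) (μ : Fin (3 + 1)) (y : Site (3 + 1))
  (hr : (-2 * c) * r = P.cE (n + 1 + 1))
  (hJW : ∀ b : ↥(pbox (towerTorus Lc (fine Lc M) (n + 1))) × Fin (3 + 1),
    hb (n + 1) b = r * perF (towerTorus Lc (fine Lc M) (n + 1)) (AN R (n + 1)) (b.1, Sum.inl b.2)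
        (wrapPt (towerTorus Lc (fine Lc M) (n + 1)) (((Lc ^ (n + 1 + 1) : ℕ) : ℤ) • y), Sum.inr μ)
      - ∑ s : ↥(pbox (towerTorus Lc (fine Lc M) (n + 1))), tgrad (towerTorus Lc (fine Lc M) (n + 1)) (b.1, Sum.inl b.2) s * l s)
  (hJΛ : w (n + 1) • ∑ ā : ↥(pbox (towerTorus Lc (fine Lc M) (n + 1))) × Fin (3 + 1), hb (n + 1) ā •
        (perF (towerTorus Lc (fine Lc M) (n + 1)) (dper (towerTorus Lc (fine Lc M) (n + 1)) (SLam N₁ (cf (n + 1)) 𝒽 ā.2 (ā.1 : Site (3 + 1))))).submatrix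
          (fun p : ↥(pbox (towerTorus Lc (fine Lc M) (n + 1))) × Fin (3 + 1) => ((p.1, Sum.inl p.2) : Idx (towerTorus Lc (fine Lc M) (n + 1)) (Fib 3)))
          (fun p : ↥(pbox (towerTorus Lc (fine Lc M) (n + 1))) × Fin (3 + 1) => ((p.1, Sum.inl p.2) : Idx (towerTorus Lc (fine Lc M) (n + 1)) (Fib 3)))
      + compSumSym Lc (onTowerFamily Lc (fine Lc M) (fun k => w k • ∑ ā : ↥(pbox (towerTorus Lc (fine Lc M) k)) × Fin (3 + 1), hb k ā •
        (perF (towerTorus Lc (fine Lc M) k) (dper (towerTorus Lc (fine Lc M) k) (SLam N₁ (cf k) 𝒽 ā.2 (ā.1 : Site (3 + 1))))).submatrix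
          (fun p : ↥(pbox (towerTorus Lc (fine Lc M) k)) × Fin (3 + 1) => ((p.1, Sum.inl p.2) : Idx (towerTorus Lc (fine Lc M) k) (Fib 3)))
          (fun p : ↥(pbox (towerTorus Lc (fine Lc M) k)) × Fin (3 + 1) => ((p.1, Sum.inl p.2) : Idx (towerTorus Lc (fine Lc M) k) (Fib 3))))) (fine Lc M) lev rs (n + 1)
    = P.cΛ (n + 1 + 1) • ∑ b : ↥(pbox (towerTorus Lc (fine Lc M) (n + 1))) × Fin (3 + 1),
        perF (towerTorus Lc (fine Lc M) (n + 1)) (AN R (n + 1)) (b.1, Sum.inl b.2)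
            (wrapPt (towerTorus Lc (fine Lc M) (n + 1)) (((Lc ^ (n + 1 + 1) : ℕ) : ℤ) • y), Sum.inr μ) •
          (perF (towerTorus Lc (fine Lc M) (n + 1)) (dper (towerTorus Lc (fine Lc M) (n + 1))
            (SLam (Lc ^ (n + 1 + 1)) (lamCoeffOf (KInv (N := Lc ^ (n + 1 + 1)) (d := 3)) (Lc ^ (n + 1 + 1))) (compH R.r Lc (n + 1 + 1)) b.2
              (b.1 : Site (3 + 1))))).submatrix
            (fun b : ↥(pbox (towerTorus Lc (fine Lc M) (n + 1))) × Fin (3 + 1) => ((b.1, Sum.inl b.2) : Idx (towerTorus Lc (fine Lc M) (n + 1)) (Fib 3)))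
            (fun b : ↥(pbox (towerTorus Lc (fine Lc M) (n + 1))) × Fin (3 + 1) => ((b.1, Sum.inl b.2) : Idx (towerTorus Lc (fine Lc M) (n + 1)) (Fib 3))))
include hH₀ hr hJW hJΛ

/-- [folklore] **`hHN1_named_of_junctions_gauge_pin` — THE ROW `hHN₁` ITSELF, AT ONE DIRECTION, FROM (J-W″) + the pin + (J-Λ)**: with the wrapper's NAMINGS at the
direction `v := dv (μ,y)` displayed as values (`hH₁ :` the `hH₁f` right side, `hH'₁ :` the `hH'₁f` right side with `X = −(c • diagonal (l ∘ pr))`, `l := lv v`) and the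
wrapper's form pin `hH₀ : H₀ = (perF T (bhKStepSh 3 Lc (Dsh Lc) 0))|ff` ((J-X) DISCHARGED: leaf-02 `perF_bhKStepSh_Dsh_ff_eq_perF_bhKStepAt` + §1 `torus_form_pureGauge_fun_of_box`):
**`H′₁ = (perF T (dper T (VN R P (n+1) μ y)))|ff`** — `hHN₁ n μ y B` on the nose once (J-W″), `(−2c)·r = cE (n+2)` and (J-Λ) are supplied. -/
theorem hHN1_named_of_junctions_gauge_pin
    {H₁ H'₁ : Matrix (↥(pbox (towerTorus Lc (fine Lc M) (n + 1))) × Fin (3 + 1)) (↥(pbox (towerTorus Lc (fine Lc M) (n + 1))) × Fin (3 + 1)) ℝ}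
    (hH₁ : H₁ = ((-2 * c) • ∑ b : ↥(pbox (towerTorus Lc (fine Lc M) (n + 1))) × Fin (3 + 1), hb (n + 1) b •
          (perF (towerTorus Lc (fine Lc M) (n + 1)) (dper (towerTorus Lc (fine Lc M) (n + 1)) (wilsonA 3 b.2 (b.1 : Site (3 + 1))))).submatrix
            (fun b : ↥(pbox (towerTorus Lc (fine Lc M) (n + 1))) × Fin (3 + 1) => ((b.1, Sum.inl b.2) : Idx (towerTorus Lc (fine Lc M) (n + 1)) (Fib 3)))
            (fun b : ↥(pbox (towerTorus Lc (fine Lc M) (n + 1))) × Fin (3 + 1) => ((b.1, Sum.inl b.2) : Idx (towerTorus Lc (fine Lc M) (n + 1)) (Fib 3)))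
        + w (n + 1) • ∑ ā : ↥(pbox (towerTorus Lc (fine Lc M) (n + 1))) × Fin (3 + 1), hb (n + 1) ā •
          (perF (towerTorus Lc (fine Lc M) (n + 1)) (dper (towerTorus Lc (fine Lc M) (n + 1)) (SLam N₁ (cf (n + 1)) 𝒽 ā.2 (ā.1 : Site (3 + 1))))).submatrix
            (fun b : ↥(pbox (towerTorus Lc (fine Lc M) (n + 1))) × Fin (3 + 1) => ((b.1, Sum.inl b.2) : Idx (towerTorus Lc (fine Lc M) (n + 1)) (Fib 3)))
            (fun b : ↥(pbox (towerTorus Lc (fine Lc M) (n + 1))) × Fin (3 + 1) => ((b.1, Sum.inl b.2) : Idx (towerTorus Lc (fine Lc M) (n + 1)) (Fib 3)))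
        + compSumSym Lc (onTowerFamily Lc (fine Lc M) (fun k => w k • ∑ ā : ↥(pbox (towerTorus Lc (fine Lc M) k)) × Fin (3 + 1), hb k ā •
          (perF (towerTorus Lc (fine Lc M) k) (dper (towerTorus Lc (fine Lc M) k) (SLam N₁ (cf k) 𝒽 ā.2 (ā.1 : Site (3 + 1))))).submatrix
            (fun b : ↥(pbox (towerTorus Lc (fine Lc M) k)) × Fin (3 + 1) => ((b.1, Sum.inl b.2) : Idx (towerTorus Lc (fine Lc M) k) (Fib 3)))
            (fun b : ↥(pbox (towerTorus Lc (fine Lc M) k)) × Fin (3 + 1) => ((b.1, Sum.inl b.2) : Idx (towerTorus Lc (fine Lc M) k) (Fib 3))))) (fine Lc M) lev rs (n + 1)))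
    (hH'₁ : H'₁ = -((-(c • Matrix.diagonal (fun b : ↥(pbox (towerTorus Lc (fine Lc M) (n + 1))) × Fin (3 + 1) => l b.1)))ᵀ * H₀) + H₁
        + H₀ * (-(c • Matrix.diagonal (fun b : ↥(pbox (towerTorus Lc (fine Lc M) (n + 1))) × Fin (3 + 1) => l b.1)))) :
    H'₁ = (perF (towerTorus Lc (fine Lc M) (n + 1)) (dper (towerTorus Lc (fine Lc M) (n + 1)) (VN R P (n + 1) μ y))).submatrix
          (fun b : ↥(pbox (towerTorus Lc (fine Lc M) (n + 1))) × Fin (3 + 1) => ((b.1, Sum.inl b.2) : Idx (towerTorus Lc (fine Lc M) (n + 1)) (Fib 3)))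
          (fun b : ↥(pbox (towerTorus Lc (fine Lc M) (n + 1))) × Fin (3 + 1) => ((b.1, Sum.inl b.2) : Idx (towerTorus Lc (fine Lc M) (n + 1)) (Fib 3))) := by
  have hH₀' : H₀ = (perF (towerTorus Lc (fine Lc M) (n + 1)) (bhKStepAt 3 (toSite (ctrOff (3 + 1) Lc)) Lc 0)).submatrix
      (fun b : ↥(pbox (towerTorus Lc (fine Lc M) (n + 1))) × Fin (3 + 1) => ((b.1, Sum.inl b.2) : Idx (towerTorus Lc (fine Lc M) (n + 1)) (Fib 3)))
      (fun b : ↥(pbox (towerTorus Lc (fine Lc M) (n + 1))) × Fin (3 + 1) => ((b.1, Sum.inl b.2) : Idx (towerTorus Lc (fine Lc M) (n + 1)) (Fib 3))) := by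
    rw [hH₀]; exact perF_bhKStepSh_Dsh_ff_eq_perF_bhKStepAt (towerTorus Lc (fine Lc M) (n + 1)) 0
  rw [hH'₁, hH₁]
  exact hHN1_shape_of_junctions_gauge R P N₁ n M lev rs 𝒽 cf w c r hb H₀ l μ y hr hJW hJΛ
    (torus_form_pureGauge_fun_of_box (towerTorus Lc (fine Lc M) (n + 1)) (toSite (ctrOff (3 + 1) Lc)) Lc l hH₀')

end Pin

end Summit.QuantumFields.BalabanUV.Beta.FP.TorusNBindingOfJunctionsGauge

end
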